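import Summits.Ventures.PercRepro.ThetaOmegaCoreNoMixed

/-!
# The square lemma, I: credit rules at a bad two-edge point

Dossier proofs/MINE1-theoremS.md, Addendum 82 (mine-1, gen 43). At a bad two-edge point `q` the
credit is exactly the edge `(∅, {q})` (`badTwo_edges`): every `q`-edge of the `A`-family has lower
end `∅` and the `C`-family has no `q`-edge. Fed into the six pair mechanisms of
`ThetaOmegaCoreMech.lean` this gives, at any edge `(s, s + q)` of `q`, the **firing lemmas**
`bt_inf_inf`, `bt_inf_sdiff`, `bt_sdiff_inf`, `bt_sdiff_sdiff` (lower end `= ∅`), `bt_cojoin`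
(`False`) and `bt_cross`, and the **rules** used by the case analysis of the square lemma:

* the diagonal rules `rule_C` (a `q`-free member with both `c1`-colours of the edge: impossible),
  `rule_D` (`s ⊆ w`), `rule_I` (`s ⊓ w = ∅`), `rule_X` (`w ⊆ s + q`) for a single member `w`;
* the edge rules `rule_T1` … `rule_T4` for an edge `(t, t + r)` of `F` in direction `r ≠ q` that
  carries both colours (`c1 t ≠ c1 (t + r)` when `q ∉ t`, `c0 t ≠ c0 (t + r)` when `q ∈ t`):
  according to the position of `r` relative to `s` they give `s ⊆ t`, `False`, `s ⊓ t = ∅` or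
  `t ⊆ s + q`.
-/

namespace PercRepro.MSTight

open Finset

variable {α : Type*} [DecidableEq α]

section Firing

variable {q : α} {U : Finset α} {F : Finset (Finset α)} {c0 c1 : Finset α → Bool} {s x y : Finset α}

/-- The meet–meet mechanism at a bad two-edge point: the lower end is empty. -/
theorem bt_inf_inf (hA : ∀ d ∈ qEdges q (omegaA F c0 c1), d = ∅)
    (hs : s ∈ F) (hqs : q ∉ s) (hsq : insert q s ∈ F)
    (hy : y ∈ F) (hys : y ≠ s) (h0y : c0 y = c0 s)
    (hx : x ∈ F) (hxu : x ≠ insert q s) (h0x : c0 x = c0 (insert q s)) (hqx : q ∈ x)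
    (heq : s ⊓ y = s ⊓ x) : s ⊓ y = ∅ :=
  hA _ (qEdge_of_inf_inf hs hqs hsq hy hys h0y hx hxu h0x hqx heq)

/-- The meet–difference mechanism at a bad two-edge point: the lower end is empty. -/
theorem bt_inf_sdiff (hA : ∀ d ∈ qEdges q (omegaA F c0 c1), d = ∅)
    (hs : s ∈ F) (hqs : q ∉ s) (hsq : insert q s ∈ F)
    (hy : y ∈ F) (hys : y ≠ s) (h0y : c0 y = c0 s)
    (hx : x ∈ F) (h0x : c0 (insert q s) = c1 x) (hqx : q ∉ x)
    (heq : s ⊓ y = s \ x) : s ⊓ y = ∅ :=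
  hA _ (qEdge_of_inf_sdiff hs hqs hsq hy hys h0y hx h0x hqx heq)

/-- The difference–meet mechanism at a bad two-edge point: the lower end is empty. -/
theorem bt_sdiff_inf (hA : ∀ d ∈ qEdges q (omegaA F c0 c1), d = ∅)
    (hs : s ∈ F) (hqs : q ∉ s) (hsq : insert q s ∈ F)
    (hy : y ∈ F) (h0y : c0 s = c1 y)
    (hx : x ∈ F) (hxu : x ≠ insert q s) (h0x : c0 x = c0 (insert q s)) (hqx : q ∈ x)
    (heq : s \ y = s ⊓ x) : s \ y = ∅ :=
  hA _ (qEdge_of_sdiff_inf hs hqs hsq hy h0y hx hxu h0x hqx heq)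

/-- The difference–difference mechanism at a bad two-edge point: the lower end is empty. -/
theorem bt_sdiff_sdiff (hA : ∀ d ∈ qEdges q (omegaA F c0 c1), d = ∅)
    (hs : s ∈ F) (hqs : q ∉ s) (hsq : insert q s ∈ F)
    (hy : y ∈ F) (h0y : c0 s = c1 y)
    (hx : x ∈ F) (h0x : c0 (insert q s) = c1 x) (hqx : q ∉ x)
    (heq : s \ y = s \ x) : s \ y = ∅ :=
  hA _ (qEdge_of_sdiff_sdiff hs hqs hsq hy h0y hx h0x hqx heq)

/-- The co-join mechanism at a bad two-edge point: impossible. -/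
theorem bt_cojoin (hC : ∀ d, d ∉ qEdges q (omegaC U F c1)) (hq : q ∈ U)
    (hs : s ∈ F) (hqs : q ∉ s) (hsq : insert q s ∈ F)
    (hy : y ∈ F) (hys : y ≠ s) (h1y : c1 y = c1 s)
    (hx : x ∈ F) (hxu : x ≠ insert q s) (h1x : c1 x = c1 (insert q s)) (hqx : q ∉ x)
    (heq : s ⊔ y = s ⊔ x) : False :=
  hC _ (qEdge_of_cojoin hq hs hqs hsq hy hys h1y hx hxu h1x hqx heq)

/-- The cross-difference mechanism at a bad two-edge point: the lower end is empty. -/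
theorem bt_cross (hA : ∀ d ∈ qEdges q (omegaA F c0 c1), d = ∅)
    (hs : s ∈ F) (hqs : q ∉ s) (hsq : insert q s ∈ F)
    (hx : x ∈ F) (hqx : q ∈ x) (h0x : c0 x = c1 s)
    (hy : y ∈ F) (h0y : c0 y = c1 (insert q s))
    (heq : x \ insert q s = y \ insert q s) : y \ insert q s = ∅ :=
  hA _ (qEdge_of_cross hs hqs hsq hx hqx h0x hy h0y heq)

end Firing

section Rules

variable {q r : α} {U : Finset α} {F : Finset (Finset α)} {c0 c1 : Finset α → Bool} {s t w : Finset α}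

/-- **Rule C**: a `q`-free member `w ≠ s` whose `c1`-colour is the `c1`-colour of both ends of the
edge `(s, s + q)` of a bad two-edge point is impossible (the co-join mechanism with `x = y = w`). -/
theorem rule_C (hC : ∀ d, d ∉ qEdges q (omegaC U F c1)) (hq : q ∈ U)
    (hs : s ∈ F) (hqs : q ∉ s) (hsq : insert q s ∈ F)
    (hw : w ∈ F) (hws : w ≠ s) (hqw : q ∉ w) (h1 : c1 w = c1 s) (h2 : c1 w = c1 (insert q s)) :
    False :=
  bt_cojoin hC hq hs hqs hsq hw hws h1 hw (ne_of_mem_notMem (mem_insert_self q s) hqw).symm h2 hqw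
    rfl

/-- **Rule D**: a `q`-free member `w` whose `c1`-colour is the `c0`-colour of both ends of the edge
`(s, s + q)` of a bad two-edge point contains `s`. -/
theorem rule_D (hA : ∀ d ∈ qEdges q (omegaA F c0 c1), d = ∅)
    (hs : s ∈ F) (hqs : q ∉ s) (hsq : insert q s ∈ F)
    (hw : w ∈ F) (hqw : q ∉ w) (h1 : c0 s = c1 w) (h2 : c0 (insert q s) = c1 w) : s \ w = ∅ :=
  bt_sdiff_sdiff hA hs hqs hsq hw h1 hw h2 hqw rfl

/-- **Rule I**: a member `w ∋ q`, `w ≠ s + q`, whose `c0`-colour is the `c0`-colour of both ends of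
the edge `(s, s + q)` of a bad two-edge point is disjoint from `s`. -/
theorem rule_I (hA : ∀ d ∈ qEdges q (omegaA F c0 c1), d = ∅)
    (hs : s ∈ F) (hqs : q ∉ s) (hsq : insert q s ∈ F)
    (hw : w ∈ F) (hqw : q ∈ w) (hwu : w ≠ insert q s) (h1 : c0 w = c0 s)
    (h2 : c0 w = c0 (insert q s)) : s ⊓ w = ∅ :=
  bt_inf_inf hA hs hqs hsq hw (ne_of_mem_notMem hqw hqs) h1 hw hwu h2 hqw rfl

/-- **Rule X**: a member `w ∋ q` whose `c0`-colour is the `c1`-colour of both ends of the edge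
`(s, s + q)` of a bad two-edge point lies inside `s + q`. -/
theorem rule_X (hA : ∀ d ∈ qEdges q (omegaA F c0 c1), d = ∅)
    (hs : s ∈ F) (hqs : q ∉ s) (hsq : insert q s ∈ F)
    (hw : w ∈ F) (hqw : q ∈ w) (h1 : c0 w = c1 s) (h2 : c0 w = c1 (insert q s)) :
    w \ insert q s = ∅ :=
  bt_cross hA hs hqs hsq hw hqw h1 hw h2 rfl

/-- **Rule T1** (`q ∉ t`, `r ∉ s`): an edge `(t, t + r)` of `F` carrying both `c1`-colours forces
`s ⊆ t` at a bad two-edge point `q` (the difference–difference mechanism). -/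
theorem rule_T1 (hA : ∀ d ∈ qEdges q (omegaA F c0 c1), d = ∅) (hqr : q ≠ r)
    (hs : s ∈ F) (hqs : q ∉ s) (hsq : insert q s ∈ F)
    (ht : t ∈ F) (htr : insert r t ∈ F) (hqt : q ∉ t) (hrs : r ∉ s)
    (hcol : c1 t ≠ c1 (insert r t)) : s \ t = ∅ := by
  obtain ⟨y, hy, hyc⟩ := exists_of_ne c1 hcol (c0 s)
  obtain ⟨x, hx, hxc⟩ := exists_of_ne c1 hcol (c0 (insert q s))
  have hmemF : ∀ z, (z = t ∨ z = insert r t) → z ∈ F := by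
    rintro z (rfl | rfl)
    · exact ht
    · exact htr
  have hmemq : ∀ z, (z = t ∨ z = insert r t) → q ∉ z := by
    rintro z (rfl | rfl)
    · exact hqt
    · exact notMem_insert_of_ne_of_notMem hqr hqt
  have heq : ∀ z, (z = t ∨ z = insert r t) → s \ z = s \ t := by
    rintro z (rfl | rfl)
    · rfl
    · exact sdiff_insert_of_notMem hrs t
  have := bt_sdiff_sdiff hA hs hqs hsq (hmemF y hy) hyc.symm (hmemF x hx) hxc.symm (hmemq x hx)
    ((heq y hy).trans (heq x hx).symm)
  rwa [heq y hy] at this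

/-- **Rule T2** (`q ∉ t`, `r ∈ s`): an edge `(t, t + r)` of `F` carrying both `c1`-colours with
`t + r ≠ s` is impossible at a bad two-edge point `q` (the co-join mechanism). -/
theorem rule_T2 (hC : ∀ d, d ∉ qEdges q (omegaC U F c1)) (hq : q ∈ U) (hqr : q ≠ r)
    (hs : s ∈ F) (hqs : q ∉ s) (hsq : insert q s ∈ F)
    (ht : t ∈ F) (hrt : r ∉ t) (htr : insert r t ∈ F) (hqt : q ∉ t) (hrs : r ∈ s)
    (hne : insert r t ≠ s) (hcol : c1 t ≠ c1 (insert r t)) : False := by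
  obtain ⟨y, hy, hyc⟩ := exists_of_ne c1 hcol (c1 s)
  obtain ⟨x, hx, hxc⟩ := exists_of_ne c1 hcol (c1 (insert q s))
  have hmemF : ∀ z, (z = t ∨ z = insert r t) → z ∈ F := by
    rintro z (rfl | rfl)
    · exact ht
    · exact htr
  have hmemq : ∀ z, (z = t ∨ z = insert r t) → q ∉ z := by
    rintro z (rfl | rfl)
    · exact hqt
    · exact notMem_insert_of_ne_of_notMem hqr hqt
  have hne_s : ∀ z, (z = t ∨ z = insert r t) → z ≠ s := by
    rintro z (rfl | rfl)
    · exact ne_of_mem_notMem hrs hrt |>.symm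
    · exact hne
  have hne_u : ∀ z, (z = t ∨ z = insert r t) → z ≠ insert q s :=
    fun z hz => (ne_of_mem_notMem (mem_insert_self q s) (hmemq z hz)).symm
  have heq : ∀ z, (z = t ∨ z = insert r t) → s ⊔ z = s ⊔ t := by
    rintro z (rfl | rfl)
    · rfl
    · rw [sup_eq_union, union_insert, insert_eq_of_mem (mem_union_left t hrs), sup_eq_union]
  exact bt_cojoin hC hq hs hqs hsq (hmemF y hy) (hne_s y hy) hyc (hmemF x hx) (hne_u x hx) hxc
    (hmemq x hx) ((heq y hy).trans (heq x hx).symm)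

/-- **Rule T3** (`q ∈ t`, `r ∉ s`): an edge `(t, t + r)` of `F` carrying both `c0`-colours with
`t ≠ s + q` forces `s ⊓ t = ∅` at a bad two-edge point `q` (the meet–meet mechanism). -/
theorem rule_T3 (hA : ∀ d ∈ qEdges q (omegaA F c0 c1), d = ∅) (hqr : q ≠ r)
    (hs : s ∈ F) (hqs : q ∉ s) (hsq : insert q s ∈ F)
    (ht : t ∈ F) (htr : insert r t ∈ F) (hqt : q ∈ t) (hrs : r ∉ s)
    (hne : t ≠ insert q s) (hcol : c0 t ≠ c0 (insert r t)) : s ⊓ t = ∅ := by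
  obtain ⟨y, hy, hyc⟩ := exists_of_ne c0 hcol (c0 s)
  obtain ⟨x, hx, hxc⟩ := exists_of_ne c0 hcol (c0 (insert q s))
  have hmemF : ∀ z, (z = t ∨ z = insert r t) → z ∈ F := by
    rintro z (rfl | rfl)
    · exact ht
    · exact htr
  have hmemq : ∀ z, (z = t ∨ z = insert r t) → q ∈ z := by
    rintro z (rfl | rfl)
    · exact hqt
    · exact mem_insert_of_mem hqt
  have hne_u : ∀ z, (z = t ∨ z = insert r t) → z ≠ insert q s := by
    rintro z (rfl | rfl)
    · exact hne
    · refine ne_of_mem_notMem (mem_insert_self r t) ?_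
      simp only [mem_insert, not_or]
      exact ⟨Ne.symm hqr, hrs⟩
  have heq : ∀ z, (z = t ∨ z = insert r t) → s ⊓ z = s ⊓ t := by
    rintro z (rfl | rfl)
    · rfl
    · exact inf_insert_of_notMem hrs t
  have := bt_inf_inf hA hs hqs hsq (hmemF y hy) (ne_of_mem_notMem (hmemq y hy) hqs) hyc
    (hmemF x hx) (hne_u x hx) hxc (hmemq x hx) ((heq y hy).trans (heq x hx).symm)
  rwa [heq y hy] at this

/-- **Rule T4** (`q ∈ t`, `r ∈ s`): an edge `(t, t + r)` of `F` carrying both `c0`-colours forces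
`t ⊆ s + q` at a bad two-edge point `q` (the cross-difference mechanism). -/
theorem rule_T4 (hA : ∀ d ∈ qEdges q (omegaA F c0 c1), d = ∅)
    (hs : s ∈ F) (hqs : q ∉ s) (hsq : insert q s ∈ F)
    (ht : t ∈ F) (htr : insert r t ∈ F) (hqt : q ∈ t) (hrs : r ∈ s)
    (hcol : c0 t ≠ c0 (insert r t)) : t \ insert q s = ∅ := by
  obtain ⟨x, hx, hxc⟩ := exists_of_ne c0 hcol (c1 s)
  obtain ⟨y, hy, hyc⟩ := exists_of_ne c0 hcol (c1 (insert q s))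
  have hmemF : ∀ z, (z = t ∨ z = insert r t) → z ∈ F := by
    rintro z (rfl | rfl)
    · exact ht
    · exact htr
  have hmemq : ∀ z, (z = t ∨ z = insert r t) → q ∈ z := by
    rintro z (rfl | rfl)
    · exact hqt
    · exact mem_insert_of_mem hqt
  have heq : ∀ z, (z = t ∨ z = insert r t) → z \ insert q s = t \ insert q s := by
    rintro z (rfl | rfl)
    · rfl
    · exact insert_sdiff_of_mem t (mem_insert_of_mem hrs)
  have := bt_cross hA hs hqs hsq (hmemF x hx) (hmemq x hx) hxc (hmemF y hy) hyc
    ((heq x hx).trans (heq y hy).symm)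
  rwa [heq y hy] at this

end Rules

section Helpers

variable {U : Finset α} {F : Finset (Finset α)} {c0 c1 : Finset α → Bool}

omit [DecidableEq α] in
/-- The points of an empty set. -/
theorem forall_notMem_of_eq_empty {s : Finset α} (h : s = ∅) (z : α) : z ∉ s := by
  rw [h]; exact notMem_empty z

omit [DecidableEq α] in
/-- Two sets agreeing at `q`, at `r` and at every other point are equal. -/
theorem ext_of_pattern (q r : α) {S1 S2 : Finset α} (hq : q ∈ S1 ↔ q ∈ S2) (hr : r ∈ S1 ↔ r ∈ S2)
    (h : ∀ z, z ≠ q → z ≠ r → (z ∈ S1 ↔ z ∈ S2)) : S1 = S2 := by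
  ext z
  by_cases hzq : z = q
  · subst hzq; exact hq
  by_cases hzr : z = r
  · subst hzr; exact hr
  exact h z hzq hzr

/-- The `A`-family is invariant under a global swap of the two colours. -/
theorem omegaA_not (F : Finset (Finset α)) (c0 c1 : Finset α → Bool) :
    omegaA F (fun s => !c0 s) (fun s => !c1 s) = omegaA F c0 c1 := by
  ext E
  simp only [mem_omegaA, Bool.not_inj_iff]

/-- The `C`-family is invariant under a global swap of the colours. -/
theorem omegaC_not (U : Finset α) (F : Finset (Finset α)) (c1 : Finset α → Bool) :
    omegaC U F (fun s => !c1 s) = omegaC U F c1 := by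
  ext E
  simp only [mem_omegaC, Bool.not_inj_iff]

end Helpers

end PercRepro.MSTight
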